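import Literature.NumberTheory.EllipticCurves.ManinConstantGamma1Gamma0ComparisonProofs
import Literature.NumberTheory.EllipticCurves.GlobalMinimalModelProofs
import Literature.NumberTheory.EllipticCurves.IsogenyVariableChangeProofs
import Literature.NumberTheory.EllipticCurves.IsogenyDualProofs
import Literature.NumberTheory.EllipticCurves.ModularCurveManinSemistableBridgeProofs
import HarnessLib

/-!
# Route `EisensteinDepletionAtTwo`, crux `StarOptBNSF` (item stmt-BirchSwinnertonDyer-27047), line `nsf` v9 —
# the PRINT stub `stub_x1Optimal` (Stevens' `X₁(N)`-optimal curve in lattice binders) from the tree's two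
# named facts MODULARITY (`exists_isNewformOf`) and CES 2003 §6.1 (`exists_optimal_gamma1ParametrizationData`)

Cell `bsd-rank2` (HOME run/shared/lean/pub/bsd-rank2/), seat `bsd-rank2-eng-2` GEN 18 (task T1; planner p2 GEN 33
«CLAIMABLE NOW: `stub_x1Optimal`», STATUS 2026-08-28T13:13:26Z).  HONEST FRAMING: a CONDITIONAL helper for an
OPEN crux child — the registered stub `stub_x1Optimal` of line `nsf` v9 is a PRINT statement (the optimal
quotient of `J₁(N)` attached to a rational newform; no `J₁(N)` in the tree), so it cannot be closed by name; this
file derives its statement VERBATIM from the two EXISTING named facts of the tree that carry exactly its print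
content, so that no new Literature fact is needed:

* `exists_isNewformOf` (Modularity, BCDT 2001 Thm. A, in the tree's form «every `E/ℚ` has a newform at level
  `N_E`»; used through `exists_optimal_modularParametrizationData_of_modularity` — the lattice-optimal
  `X₀(N)`-datum of the strong Weil curve of the class, a tree theorem modulo Modularity — and through
  `IsNewformOf.level_eq_conductorNorm_of_exists_isNewformOf`, level `=` conductor);
* `exists_optimal_gamma1ParametrizationData` (Conrad–Edixhoven–Stein 2003 §6.1 Def. 6.1.4 / Lemma 6.1.6 with
  Stevens 1989 §2: the OPTIMAL `X₁(N)`-datum of the class of an `X₀(N)`-optimal curve, `Λ_{E₁} = c₁Λ₁(f)`,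
  `c₁ ∈ ℤ`).

* `x1OptimalLattice_of_modularity` — **for every elliptic `W₀/ℚ` with newform `f ∈ S₂(Γ₀(N))` there is a
  globally minimal elliptic `W₁/ℚ` with newform `f` and a Néron period pair `L₁` with `Λ_{L₁} = c₁·Λ₁(f)`,
  `c₁ ∈ ℚˣ`** — the statement of `Holds.stub_x1Optimal` (skeleton `Cruxes/StarOptBNSF/Lines/nsf.lean` v9)
  verbatim, conditional on the two named facts.  Route: global minimal model of `W₀`
  (`hasGlobalMinimalModel_rat_holds`) ⇒ strong Weil curve `W₂ ∼ W₀` with its lattice-optimal `X₀(N)`-datum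
  `D₀` (`exists_optimal_modularParametrizationData_of_modularity`, `latticeEq_of_forall_modularDegree_le`),
  `D₀.f = f` (strong multiplicity one, `IsNewformOf.unique`) ⇒ Stevens' curve `W₁ ∼ W₂` with optimal
  `X₁(N)`-datum `D₁` (`exists_optimal_gamma1ParametrizationData`), `D₁.f = f` (isogenous curves share the
  newform, `IsNewformOf.of_isIsogenous`), `c₁ = D₁.c ≠ 0` (`Gamma1ParametrizationData.maninConstant_ne_zero`).

Nothing here reads an analytic rank; `StarOptBNSF` / `E1M_NSF` / BSD are NOT proved (PARTITION D-0054: none —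
r_an ≥ 2, summit axis S0).

References: G. Stevens, Invent. Math. 98 (1989), §2 (Thm. 1.6); B. Conrad, B. Edixhoven, W. Stein, *`J₁(p)` has
connected fibers*, Doc. Math. 8 (2003), §6.1; C. Breuil, B. Conrad, F. Diamond, R. Taylor, JAMS 14 (2001), Thm. A.
-/

set_option linter.dupNamespace false -- `Summit.BirchSwinnertonDyer.BirchSwinnertonDyer` (summit = problem, D-0017)
set_option autoImplicit false

noncomputable section

open scoped Classical
open Literature.NumberTheory.EllipticCurves Literature.NumberTheory.EllipticCurves.ModularForms
open Literature.NumberTheory.Automorphic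

namespace Summit.BirchSwinnertonDyer.BirchSwinnertonDyer.Theorems.DepletionAtTwo.X1Optimal

/-- **Stevens' `X₁(N)`-optimal curve in lattice binders, from Modularity + CES 2003 §6.1.**  For every elliptic
`W₀/ℚ` with newform `f ∈ S₂(Γ₀(N))`: a globally minimal elliptic `W₁/ℚ` with `IsNewformOf W₁ f`, a Néron period
pair `L₁` of `W₁` and `c₁ ∈ ℚˣ` with `c₁·Λ₁(f) ⊆ Λ_{L₁} ⊆ c₁·Λ₁(f)` — the statement of the PRINT stub
`stub_x1Optimal` of line `nsf` v9, conditional on the named facts `exists_isNewformOf` (Modularity) and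
`exists_optimal_gamma1ParametrizationData` (optimal quotient of `J₁(N)`).
[cite: ConradEdixhovenStein2003, §6.1, Def. 6.1.4 and Lemma 6.1.6] [cite: Stevens1989, §2] [cite: BCDTJAMS2001, Thm. A] -/
theorem x1OptimalLattice_of_modularity (hnf : exists_isNewformOf)
    (hex : exists_optimal_gamma1ParametrizationData) :
    ∀ (W₀ : WeierstrassCurve ℚ) [W₀.IsElliptic]
      ⦃N : ℕ⦄ [NeZero N] (f : CuspForm (CongruenceSubgroup.Gamma0 N) 2), IsNewformOf W₀ f →
      ∃ (W₁ : WeierstrassCurve ℚ) (_ : W₁.IsElliptic) (_ : W₁.IsGloballyMinimal) (L₁ : PeriodPair) (c₁ : ℚ),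
        IsNewformOf W₁ f ∧ IsNeronLatticeOf (W₁.baseChange ℂ) L₁ ∧ c₁ ≠ 0 ∧
          (∀ z ∈ periodLatticeGamma1 f, (c₁ : ℂ) * z ∈ L₁.lattice) ∧
          (∀ z ∈ L₁.lattice, ∃ w ∈ periodLatticeGamma1 f, z = (c₁ : ℂ) * w) := by
  intro W₀ _ N _ f hW₀
  -- a global minimal model `C • W₀` of the given curve (same newform)
  obtain ⟨C, hC⟩ := WeierstrassCurve.hasGlobalMinimalModel_rat_holds W₀
  haveI := hC
  have hW₀' : IsNewformOf (C • W₀) f :=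
    hW₀.of_isIsogenous (WeierstrassCurve.isIsogenous_of_smul W₀ C)
  -- the level is the conductor (Modularity + strong multiplicity one)
  have hN : N = (C • W₀).conductorNorm ℤ :=
    IsNewformOf.level_eq_conductorNorm_of_exists_isNewformOf hnf hW₀'
  -- the strong Weil curve `W₂` of the class with its lattice-optimal `X₀(N)`-datum `D₀`
  obtain ⟨W₂, hE₂, hM₂, D₀, hfD₀, hiso₂, hmin⟩ :=
    exists_optimal_modularParametrizationData_of_modularity hnf N (C • W₀) hN.symm
  haveI := hE₂
  haveI := hM₂
  have hD₀f : D₀.f = f := hfD₀.unique hW₀'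
  have h₀ : ∀ z ∈ D₀.L.lattice, ∃ w ∈ periodLattice D₀.f, z = D₀.c * w :=
    D₀.latticeEq_of_forall_modularDegree_le hmin
  -- Stevens' `X₁(N)`-optimal curve `W₁` of the class with its optimal datum `D₁`
  obtain ⟨W₁, i₁, i₂, D₁, hiso₁, hopt⟩ := hex W₂ D₀ h₀
  have hW₂ : IsNewformOf W₂ f := hW₀'.of_isIsogenous hiso₂.symm_of_charZero
  have hW₁ : IsNewformOf W₁ f := hW₂.of_isIsogenous hiso₁
  have hD₁f : D₁.f = f := D₁.isNewformOf.unique hW₁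
  have hc₁ : (D₁.c : ℚ) ≠ 0 := by exact_mod_cast D₁.maninConstant_ne_zero
  refine ⟨W₁, i₁, i₂, D₁.L, (D₁.c : ℚ), hW₁, D₁.isNeronLattice, hc₁, ?_, ?_⟩
  · intro z hz
    have h := D₁.smul_periodLatticeGamma1_le z (hD₁f ▸ hz)
    push_cast
    exact h
  · intro z hz
    obtain ⟨w, hw, hzw⟩ := hopt z hz
    refine ⟨w, hD₁f ▸ hw, ?_⟩
    push_cast
    exact hzw

end Summit.BirchSwinnertonDyer.BirchSwinnertonDyer.Theorems.DepletionAtTwo.X1Optimal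

end
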